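import Literature.AnabelianGeometry.SemiGraphs.ProSigmaCentralPairs
import Literature.AnabelianGeometry.SemiGraphs.ProSigmaPuncturedSlim
import Literature.AnabelianGeometry.SemiGraphs.ProSigmaCompletionInjective
import Literature.GroupTheory.CombinatorialGroupTheory.SurfaceGroupIsotropicCharacterPairs
import Literature.GroupTheory.CombinatorialGroupTheory.SurfaceGroupConjugacySeparable
import Mathlib.Algebra.Module.ZMod
import HarnessLib

/-!
# The `𝔽_p`-character space of an open subgroup of a pro-`Σ` surface group (modulo F_cov)

[AbsAnab] (Mochizuki, *The absolute anabelian geometry of hyperbolic curves*, 2004) Lemma 1.3.1 p. 15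
[cite: MochizukiAbsAnab2004, Lemma 1.3.1 p.15], proper case, pro-`Σ` form; [SemiAnbd] Example 2.10 p. 31
("verticially slim") [cite: MochizukiSemiAnbd2006, Ex. 2.10 p.31].  Preparations for
`ProSigmaClosedSurfaceSlim.lean` (slimness of pro-`Σ` completions of closed surface groups of genus `≥ 2`,
modulo the tree's named fact `SurfaceGroupFiniteIndexSubgroup` = "F_cov": a finite-index subgroup of
`S_g` is an `S_h`, `h = j (g - 1) + 1`, Zieschang–Vogt–Coldewey 4.14.22):

* `nonempty_mulEquiv_puncturedSurfaceGroup_zero` — `Γ_{g,0} ≅ S_g` (the closed punctured-surface group of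
  `PuncturedSurfaceGroup.lean` is the surface group of `GroupTrisections.lean`);
* `exists_characterSpace` — for `Γ ≅ S_g` (`g ≥ 2`), `ι : Γ → P` a pro-`Σ` completion (`P` profinite),
  `p ∈ Σ`, `U ⊆ P` open and `τ, κ ∈ U`: `ι⁻¹(U) ≅ S_{h'}` (F_cov), every `𝔽_p`-character of `S_{h'}`
  extends UNIQUELY to a continuous character `F_v` of `U` (abc-iut-L5-t9's `exists_continuous_extend`,
  `continuous_ext_on`), and the evaluations `v ↦ F_v(τ)`, `v ↦ F_v(κ)` are `𝔽_p`-LINEAR functionals;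
* `exists_shrink` — an open `U' ⊆ U` still containing `τ, κ` with `[Γ : ι⁻¹(U')] ≥ 2` (the kernel of a
  nonzero character vanishing at `τ, κ`), so that `ι⁻¹(U') ≅ S_{h''}` with `h'' ≥ 3`.

CONDITIONAL on the named fact F_cov (typed ≠ proved for it); theorems only; classical profinite group
theory; nothing here bears on [IUTchIII] Cor. 3.12.
-/
noncomputable section

namespace Literature.AnabelianGeometry.SemiGraphs.SemiGraphOfAnabelioids.IsProSigmaCompletion

open Literature.AnabelianGeometry.Anabelioids Literature.AlgebraicGeometry.Frobenioids Topology
open Multiplicative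
open Literature.GroupTheory.CombinatorialGroupTheory
open Literature.Topology.FourManifolds (SurfaceGroup surfaceGen surfaceRelator)

universe u v₁ u₁

/-! ### The closed surface group `Γ_{g,0}` is the surface group `S_g` of the `FourManifolds` files -/

/-- The relabelling `(Fin g × Bool) ⊕ Fin 0 ≃ Fin g × Bool` carries the relator `∏[aᵢ,bᵢ] · (empty product)`
of `Γ_{g,0}` to the surface relator `∏[aᵢ,bᵢ]`. [cite: MochizukiSemiAnbd2006, Ex. 2.10 p.31] -/
theorem freeGroupCongr_relator_zero (g : ℕ) :
    FreeGroup.freeGroupCongr (Equiv.sumEmpty (Fin g × Bool) (Fin 0)) (PuncturedSurfaceGroup.relator g 0) =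
      surfaceRelator g := by
  rw [PuncturedSurfaceGroup.relator, surfaceRelator, map_mul, map_list_prod, map_list_prod, List.map_map,
    List.map_map, List.finRange_zero, List.map_nil, List.prod_nil, mul_one]
  refine congrArg List.prod (List.map_congr_left fun i _ => ?_)
  simp only [Function.comp_apply, map_mul, map_inv, FreeGroup.freeGroupCongr_apply, FreeGroup.map.of,
    PuncturedSurfaceGroup.genA, PuncturedSurfaceGroup.genB, Literature.Topology.FourManifolds.genA,
    Literature.Topology.FourManifolds.genB, Equiv.sumEmpty_apply_inl]

/-- **`Γ_{g,0} ≅ S_g`**: the closed punctured-surface group of `PuncturedSurfaceGroup.lean` is the surface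
group of `GroupTrisections.lean`. [cite: MochizukiSemiAnbd2006, Ex. 2.10 p.31] -/
theorem nonempty_mulEquiv_puncturedSurfaceGroup_zero (g : ℕ) :
    Nonempty (PuncturedSurfaceGroup g 0 ≃* SurfaceGroup g) := by
  have hs : FreeGroup.freeGroupCongr (Equiv.sumEmpty (Fin g × Bool) (Fin 0)) ''
      ({PuncturedSurfaceGroup.relator g 0} : Set (FreeGroup (puncturedSurfaceGen g 0))) =
      {surfaceRelator g} := by
    rw [Set.image_singleton, freeGroupCongr_relator_zero]
  have e := PresentedGroup.equivPresentedGroup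
    ({PuncturedSurfaceGroup.relator g 0} : Set (FreeGroup (puncturedSurfaceGen g 0)))
    (Equiv.sumEmpty (Fin g × Bool) (Fin 0))
  rw [hs] at e
  exact ⟨e⟩

variable {Sigma : Set ℕ} {Γ : Type*} [Group Γ] {P : Type*} [Group P] [TopologicalSpace P]
  {ι : Γ →* P}

/-- A prime in `Σ` is a `Σ`-integer. [cite: MochizukiSemiAnbd2006, Def. 2.9(i) p.31] -/
theorem isSigmaInteger_prime {p : ℕ} (hp : p.Prime) (hpS : p ∈ Sigma) : IsSigmaInteger Sigma p :=
  ⟨hp.pos, fun _ hq hqp => ((Nat.prime_dvd_prime_iff_eq hq hp).mp hqp) ▸ hpS⟩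

section Profinite

variable [IsTopologicalGroup P] [CompactSpace P] [TotallyDisconnectedSpace P]

/-! ### The `𝔽_p`-character space of an open subgroup of a pro-`Σ` surface group -/

/-- **The character space of an open subgroup.**  Let `Γ ≅ S_g` (`g ≥ 2`), `ι : Γ → P` a pro-`Σ` completion
(`P` profinite), `p ∈ Σ` prime, `U ⊆ P` open and `τ, κ ∈ U`.  Then (F_cov) `ι⁻¹(U) ≅ S_{h'}` with
`h' = [Γ : ι⁻¹(U)] (g - 1) + 1`, and there is an assignment `v ↦ F_v` of a CONTINUOUS character
`F_v : U → 𝔽_p` to every value vector `v ∈ 𝔽_p^{2h'}`, extending the character of `S_{h'}` with values `v`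
on the generators (abc-iut-L5-t9's `exists_continuous_extend`), UNIQUE among continuous characters with
this restriction (`continuous_ext_on`), and such that `v ↦ F_v(τ)`, `v ↦ F_v(κ)` are `𝔽_p`-LINEAR
functionals `E₁, E₂`. [cite: MochizukiAbsAnab2004, Lemma 1.3.1 p.15] -/
theorem exists_characterSpace (hF : SurfaceGroupFiniteIndexSubgroup) {g : ℕ} (hg : 2 ≤ g)
    (e : Γ ≃* SurfaceGroup g) (hι : IsProSigmaCompletion Sigma ι) {p : ℕ} [hp : Fact p.Prime]
    (hpS : p ∈ Sigma) (U : Subgroup P) (hU : IsOpen (U : Set P)) {τ κ : P} (hτ : τ ∈ U) (hκ : κ ∈ U) :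
    ∃ (h' : ℕ) (_ : h' = (U.comap ι).index * (g - 1) + 1) (e' : U.comap ι ≃* SurfaceGroup h')
      (Fext : (surfaceGen h' → ZMod p) → (U →* Multiplicative (ZMod p)))
      (E₁ E₂ : (surfaceGen h' → ZMod p) →ₗ[ZMod p] ZMod p),
      (∀ v, Continuous (Fext v)) ∧
      (∀ v γ (hγ : γ ∈ U.comap ι), Fext v ⟨ι γ, hγ⟩ =
        Literature.Topology.FourManifolds.SurfaceGroup.toCommGroup (fun x => ofAdd (v x)) (e' ⟨γ, hγ⟩)) ∧
      (∀ v (G : U →* Multiplicative (ZMod p)), Continuous G →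
        (∀ γ (hγ : γ ∈ U.comap ι), G ⟨ι γ, hγ⟩ =
          Literature.Topology.FourManifolds.SurfaceGroup.toCommGroup (fun x => ofAdd (v x)) (e' ⟨γ, hγ⟩)) →
        G = Fext v) ∧
      (∀ v, Fext v ⟨τ, hτ⟩ = ofAdd (E₁ v)) ∧ (∀ v, Fext v ⟨κ, hκ⟩ = ofAdd (E₂ v)) := by
  classical
  haveI : NeZero p := ⟨hp.out.ne_zero⟩
  -- (1) `ι⁻¹(U) ≅ S_{h'}` by F_cov
  let S' : Subgroup Γ := U.comap ι
  haveI hS'fi : S'.FiniteIndex := finiteIndex_comap hι U hU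
  let K' : Subgroup (SurfaceGroup g) := S'.map (e : Γ →* SurfaceGroup g)
  have hK'idx : K'.index = S'.index := Subgroup.index_map_equiv S' e
  have hK'fi : K'.FiniteIndex := ⟨by rw [hK'idx]; exact hS'fi.index_ne_zero⟩
  obtain ⟨h', hh', ⟨e₂⟩⟩ := hF g hg K' hK'fi
  let e' : S' ≃* SurfaceGroup h' := (e.subgroupMap S').trans e₂
  -- (2) extension of characters
  have hQ : IsSigmaInteger Sigma (Nat.card (Multiplicative (ZMod p))) := by
    rw [show Nat.card (Multiplicative (ZMod p)) = p from Nat.card_zmod p]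
    exact isSigmaInteger_prime hp.out hpS
  have hex : ∀ v : surfaceGen h' → ZMod p, ∃ F : U →* Multiplicative (ZMod p), Continuous F ∧
      ∀ γ (hγ : γ ∈ S'), F ⟨ι γ, hγ⟩ =
        (Literature.Topology.FourManifolds.SurfaceGroup.toCommGroup (fun x => ofAdd (v x))).comp
          e'.toMonoidHom ⟨γ, hγ⟩ :=
    fun v => exists_continuous_extend hι U hU hQ _
  choose Fext hFc hFext using hex
  have hFext' : ∀ v γ (hγ : γ ∈ S'), Fext v ⟨ι γ, hγ⟩ =
      Literature.Topology.FourManifolds.SurfaceGroup.toCommGroup (fun x => ofAdd (v x)) (e' ⟨γ, hγ⟩) :=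
    fun v γ hγ => hFext v γ hγ
  -- uniqueness
  have huniq : ∀ v (G : U →* Multiplicative (ZMod p)), Continuous G →
      (∀ γ (hγ : γ ∈ S'), G ⟨ι γ, hγ⟩ =
        Literature.Topology.FourManifolds.SurfaceGroup.toCommGroup (fun x => ofAdd (v x)) (e' ⟨γ, hγ⟩)) →
      G = Fext v := by
    intro v G hGc hG
    apply DFunLike.coe_injective
    exact continuous_ext_on hι U hU hGc (hFc v) fun γ hγ => by rw [hG γ hγ, hFext' v γ hγ]
  -- additivity of `v ↦ Fext v`
  have hadd : ∀ u v, Fext (u + v) = Fext u * Fext v := by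
    intro u v
    refine (huniq (u + v) (Fext u * Fext v) ((hFc u).mul (hFc v)) fun γ hγ => ?_).symm
    rw [MonoidHom.mul_apply, hFext' u γ hγ, hFext' v γ hγ,
      Literature.GroupTheory.CombinatorialGroupTheory.SurfaceGroup.toCommGroup_ofAdd_add, MonoidHom.mul_apply]
  -- the two evaluation functionals
  let E₁' : (surfaceGen h' → ZMod p) →+ ZMod p :=
    AddMonoidHom.mk' (fun v => toAdd (Fext v ⟨τ, hτ⟩)) fun u v => by
      rw [hadd, MonoidHom.mul_apply, toAdd_mul]
  let E₂' : (surfaceGen h' → ZMod p) →+ ZMod p :=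
    AddMonoidHom.mk' (fun v => toAdd (Fext v ⟨κ, hκ⟩)) fun u v => by
      rw [hadd, MonoidHom.mul_apply, toAdd_mul]
  refine ⟨h', hh'.trans (by rw [hK'idx]), e', Fext, E₁'.toZModLinearMap p, E₂'.toZModLinearMap p,
    hFc, hFext', huniq, fun v => ?_, fun v => ?_⟩
  · change Fext v ⟨τ, hτ⟩ = ofAdd (toAdd (Fext v ⟨τ, hτ⟩))
    rw [ofAdd_toAdd]
  · change Fext v ⟨κ, hκ⟩ = ofAdd (toAdd (Fext v ⟨κ, hκ⟩))
    rw [ofAdd_toAdd]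

/-! ### Shrinking the open subgroup to raise the genus -/

/-- **Shrinking.**  In the situation of `exists_characterSpace`, there is an open subgroup `U' ⊆ U` still
containing `τ` and `κ` with `[Γ : ι⁻¹(U')] ≥ 2` (so that `ι⁻¹(U') ≅ S_{h''}` with `h'' ≥ 3`): the kernel of
the continuous extension of a NONZERO character of `ι⁻¹(U) ≅ S_{h'}` vanishing at `τ` and `κ` (one exists:
the common kernel of the two evaluation functionals has dimension `≥ 2h' - 2 ≥ 2`).
[cite: MochizukiAbsAnab2004, Lemma 1.3.1 p.15] -/
theorem exists_shrink (hF : SurfaceGroupFiniteIndexSubgroup) {g : ℕ} (hg : 2 ≤ g)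
    (e : Γ ≃* SurfaceGroup g) (hι : IsProSigmaCompletion Sigma ι) {p : ℕ} [hp : Fact p.Prime]
    (hpS : p ∈ Sigma) (U : Subgroup P) (hU : IsOpen (U : Set P)) {τ κ : P} (hτ : τ ∈ U) (hκ : κ ∈ U) :
    ∃ U' : Subgroup P, U' ≤ U ∧ IsOpen (U' : Set P) ∧ τ ∈ U' ∧ κ ∈ U' ∧ 2 ≤ (U'.comap ι).index := by
  classical
  haveI : NeZero p := ⟨hp.out.ne_zero⟩
  obtain ⟨h', hh', e', Fext, E₁, E₂, hFc, hFext, -, hE₁, hE₂⟩ :=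
    exists_characterSpace hF hg e hι hpS U hU hτ hκ
  haveI hS'fi : (U.comap ι).FiniteIndex := finiteIndex_comap hι U hU
  have hh2 : 2 ≤ h' := two_le_genus_of_index hg hS'fi.index_ne_zero hh'
  -- a nonzero `w` killed by both evaluation functionals
  obtain ⟨w, hwK, hw0⟩ : ∃ w ∈ LinearMap.ker (E₁.prod E₂), w ≠ 0 := by
    apply Submodule.exists_mem_ne_zero_of_ne_bot
    intro hbot
    have hrn := LinearMap.finrank_range_add_finrank_ker (E₁.prod E₂)
    rw [hbot, finrank_bot, add_zero, Module.finrank_fintype_fun_eq_card, Fintype.card_prod,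
      Fintype.card_fin, Fintype.card_bool] at hrn
    have hr : Module.finrank (ZMod p) (LinearMap.range (E₁.prod E₂)) ≤ 2 := by
      calc Module.finrank (ZMod p) (LinearMap.range (E₁.prod E₂))
          ≤ Module.finrank (ZMod p) (ZMod p × ZMod p) := Submodule.finrank_le _
        _ = 2 := by rw [Module.finrank_prod, Module.finrank_self]
    omega
  rw [LinearMap.ker_prod, Submodule.mem_inf, LinearMap.mem_ker, LinearMap.mem_ker] at hwK
  -- `U' = Ker (Fext w)`
  let lam : U →* Multiplicative (ZMod p) := Fext w
  let U' : Subgroup P := lam.ker.map U.subtype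
  have hU'le : U' ≤ U := Subgroup.map_subtype_le _
  have hmemU' : ∀ (x : P) (hx : x ∈ U), lam ⟨x, hx⟩ = 1 → x ∈ U' := fun x hx h1 => ⟨⟨x, hx⟩, h1, rfl⟩
  have hU'mem : ∀ (x : P) (hx : x ∈ U), x ∈ U' → lam ⟨x, hx⟩ = 1 := by
    rintro x hx ⟨y, hy, hyx⟩
    have : y = ⟨x, hx⟩ := Subtype.ext hyx
    rw [← this]
    exact hy
  refine ⟨U', hU'le, ?_, ?_, ?_, ?_⟩
  · -- open
    have hko : IsOpen (lam.ker : Set U) := (isOpen_discrete ({1} : Set _)).preimage (hFc w)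
    have : (U' : Set P) = Subtype.val '' (lam.ker : Set U) := Subgroup.coe_map _ _
    rw [this]
    exact hU.isOpenMap_subtype_val _ hko
  · exact hmemU' τ hτ (by change Fext w ⟨τ, hτ⟩ = 1; rw [hE₁, hwK.1, ofAdd_zero])
  · exact hmemU' κ hκ (by change Fext w ⟨κ, hκ⟩ = 1; rw [hE₂, hwK.2, ofAdd_zero])
  · -- index `≥ 2`: otherwise `ι⁻¹(U') = Γ`, so the character with values `w` is trivial
    have hU'o : IsOpen (U' : Set P) := by
      have hko : IsOpen (lam.ker : Set U) := (isOpen_discrete ({1} : Set _)).preimage (hFc w)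
      have : (U' : Set P) = Subtype.val '' (lam.ker : Set U) := Subgroup.coe_map _ _
      rw [this]
      exact hU.isOpenMap_subtype_val _ hko
    haveI hfi : (U'.comap ι).FiniteIndex := finiteIndex_comap hι U' hU'o
    by_contra hlt
    have h1 : (U'.comap ι).index = 1 := by
      have := hfi.index_ne_zero
      omega
    rw [Subgroup.index_eq_one] at h1
    apply hw0
    -- every generator value vanishes
    have hall : ∀ s : SurfaceGroup h',
        Literature.Topology.FourManifolds.SurfaceGroup.toCommGroup (fun x => ofAdd (w x)) s = 1 := by
      intro s
      obtain ⟨⟨γ, hγ⟩, rfl⟩ := e'.surjective s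
      have hγU' : ι γ ∈ U' := by
        have : γ ∈ U'.comap ι := by rw [h1]; exact Subgroup.mem_top γ
        exact this
      rw [← hFext w γ hγ]
      exact hU'mem (ι γ) hγ hγU'
    funext x
    have hx := hall (PresentedGroup.of x)
    rw [Literature.Topology.FourManifolds.SurfaceGroup.toCommGroup_of, ofAdd_eq_one] at hx
    exact hx

end Profinite

end Literature.AnabelianGeometry.SemiGraphs.SemiGraphOfAnabelioids.IsProSigmaCompletion

end
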